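import Summits.AtomisticToContinuum.FouriersLaw.Theorems.ContactStieltjesMeasureStieltjesRepresentationStubBoundaryGreenKubo
import Summits.AtomisticToContinuum.FouriersLaw.Theorems.ContactStieltjesMeasureStieltjesRepresentationStubMixedEdges

/-!
# Stub `stub_boundaryGreenKuboNonneg` of line `cayley-pencil` (crux `ContactStieltjesMeasure.StieltjesRepresentation`,
# stmt-AtomisticToContinuum-15248, skeleton v3): the boundary-power Green–Kubo formula on `0 ≤ lam`

Helper file (`--supports stmt-AtomisticToContinuum-15248`). Skeleton v3 widens stub 1 of the line from `0 < lam` to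
`0 ≤ lam` (the edge `lam = 0 < β` of the crux's parameter square belongs to the Cuneo–Eckmann–Hairer–Rey-Bellet range):
the proof is that of the landed `stub_boundaryGreenKubo` (`…StubBoundaryGreenKubo`, whose internal lemmas are all stated for
`0 ≤ lam`) with the landed `openChainGreenKubo_of_nonneg` (`…StubMixedEdges`, the open-chain Green–Kubo cone re-elaborated at
`0 ≤ lam`) in place of `openChainGreenKubo_holds`. No definitions.
-/

noncomputable section

open MeasureTheory ProbabilityTheory Filter Topology Set Function
open scoped NNReal ENNReal BigOperators

namespace Summit.AtomisticToContinuum.FouriersLaw.Theorems.ContactStieltjesMeasure.CayleyPencil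

open Literature.MathematicalPhysics.KineticTheory.HeatConduction
open BoundaryGreenKubo

/-- **STUB `stub_boundaryGreenKuboNonneg` of line `cayley-pencil`** (skeleton v3; crux
`ContactStieltjesMeasure.StieltjesRepresentation`): the open-chain Green–Kubo formula in BOUNDARY-POWER form for
`pinnedChain ω₂ lam β γ` with `ω₂, β, γ > 0` and `lam ≥ 0`. Under weak-NESS uniqueness, along every steady family, for
`T > 0` and `N ≥ 2`: `corr(g₀,g₀) ∈ L¹(0,∞)` for the boundary power `g₀ = p_0 ∂_{q_0}H`, and the two-terminal response
quotient converges to `(N-1)·(∫₀^∞ corr(g₀,g₀))/T²` — from `openChainGreenKubo_of_nonneg` (limit `∫₀^∞corr(J,J)/((N-1)T²)`)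
and `∫₀^∞corr(J,J) = (N-1)²∫₀^∞corr(g₀,g₀)` (`integral_corr_totalCurrent_eq_sq_mul_boundaryPower`). Statement `let`-free
(registered form). [cite: KunduDharNarayan2009, p. 3] [cite: CuneoEckmannHairerReyBellet2018, Thm 2.13] -/
theorem stub_boundaryGreenKuboNonneg :
    ∀ ω₂ lam β γ : ℝ, 0 < ω₂ → 0 ≤ lam → 0 < β → 0 < γ →
      (∀ (N : ℕ) (T_L T_R : ℝ), 0 < T_L → 0 < T_R → ∀ μ ν : Measure (PhaseSpace N),
        (pinnedChain ω₂ lam β γ).IsSteadyState N T_L T_R μ →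
        (pinnedChain ω₂ lam β γ).IsSteadyState N T_L T_R ν → μ = ν) →
      ∀ μf : (N : ℕ) → ℝ → ℝ → Measure (PhaseSpace N),
        (∀ (N : ℕ) (T_L T_R : ℝ), 0 < T_L → 0 < T_R →
          (pinnedChain ω₂ lam β γ).IsSteadyState N T_L T_R (μf N T_L T_R)) →
      ∀ T : ℝ, 0 < T → ∀ (N : ℕ) (hN : 2 ≤ N),
        IntegrableOn (fun t : ℝ =>
            (∫ z, (z.2 ⟨0, by omega⟩ * partialQ ⟨0, by omega⟩ ((pinnedChain ω₂ lam β γ).hamiltonian N) z) *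
                (∫ y, y.2 ⟨0, by omega⟩ * partialQ ⟨0, by omega⟩ ((pinnedChain ω₂ lam β γ).hamiltonian N) y
                  ∂((pinnedChain ω₂ lam β γ).transitionKernel N T T t.toNNReal z)) ∂((pinnedChain ω₂ lam β γ).gibbsMeasure N T)) -
              (∫ z, z.2 ⟨0, by omega⟩ * partialQ ⟨0, by omega⟩ ((pinnedChain ω₂ lam β γ).hamiltonian N) z ∂((pinnedChain ω₂ lam β γ).gibbsMeasure N T)) *
                (∫ z, z.2 ⟨0, by omega⟩ * partialQ ⟨0, by omega⟩ ((pinnedChain ω₂ lam β γ).hamiltonian N) z ∂((pinnedChain ω₂ lam β γ).gibbsMeasure N T))) (Set.Ioi 0) ∧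
        Tendsto (fun δ : ℝ => (pinnedChain ω₂ lam β γ).totalCurrent (μf N (T + δ / 2) (T - δ / 2)) / δ) (𝓝[≠] 0)
          (𝓝 (((N : ℝ) - 1) * ((∫ t in Set.Ioi (0 : ℝ), (fun t : ℝ =>
            (∫ z, (z.2 ⟨0, by omega⟩ * partialQ ⟨0, by omega⟩ ((pinnedChain ω₂ lam β γ).hamiltonian N) z) *
                (∫ y, y.2 ⟨0, by omega⟩ * partialQ ⟨0, by omega⟩ ((pinnedChain ω₂ lam β γ).hamiltonian N) y
                  ∂((pinnedChain ω₂ lam β γ).transitionKernel N T T t.toNNReal z)) ∂((pinnedChain ω₂ lam β γ).gibbsMeasure N T)) -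
              (∫ z, z.2 ⟨0, by omega⟩ * partialQ ⟨0, by omega⟩ ((pinnedChain ω₂ lam β γ).hamiltonian N) z ∂((pinnedChain ω₂ lam β γ).gibbsMeasure N T)) *
                (∫ z, z.2 ⟨0, by omega⟩ * partialQ ⟨0, by omega⟩ ((pinnedChain ω₂ lam β γ).hamiltonian N) z ∂((pinnedChain ω₂ lam β γ).gibbsMeasure N T))) t) / T ^ 2))) := by
  intro ω₂ lam β γ hω hl hβ hγ hU μf hμf T hT N hN
  obtain ⟨-, h2⟩ := openChainGreenKubo_of_nonneg ω₂ lam β γ hω hl hβ hγ hU μf hμf T hT N hN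
  refine ⟨integrableOn_corr_boundaryPower hω hl hβ hγ hN hT, ?_⟩
  have key := integral_corr_totalCurrent_eq_sq_mul_boundaryPower hω hl hβ hγ hN hT
  have hN1 : (N : ℝ) - 1 ≠ 0 := by
    have : (2 : ℝ) ≤ N := by exact_mod_cast hN
    linarith
  convert h2 using 2
  rw [key]
  field_simp

end Summit.AtomisticToContinuum.FouriersLaw.Theorems.ContactStieltjesMeasure.CayleyPencil

end
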